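import Mathlib.Tactic.Linarith
import Mathlib.Tactic.Ring
import Mathlib.Tactic.NormNum
import HarnessLib

/-!
# The (0,1) cell of the ι-window, EXISTENCE side, IX: the record curve `R` at the node parameter is EMPTY —
# arithmetic skeleton of `H2-EXISTENCE-SIDE-9.md`

Family `hodge`, b2b cell `hweil`, `Summits/HodgeConjecture/HodgeConjecture/Theorems` (helper of item stmt-HodgeConjecture-2524, the
Weil-sixfold rung the H2 test serves). Companion to `WeilTypeLadderH2W2CornerEight.lean` (pv3-g15, [VIII]) with the SAME dictionary: `X = J(C)`, `C`
general of genus `4`, `ι = −1`, `Θ = W₃ − κ` with nodes `±n`, `D_n = Θ_n ∪ Θ_{−n}`, `S_n = C − C` with vertex `0`, the saturated corner sheaves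
`F̂_t` of [VII] 9.2 indexed by the pinching triple `t = (z₁, z₂, z₃)`, the record curve `R = {z₁ + z₂ + z₃ ∈ |g|}`, the vertex module
`M = F̂_{t₀,0}` over `R = k[[x,y,z,w]]` (ι-linear coordinates), its fibre `V = M ⊗ k = V₊ ⊕ V₋`, `U = 𝔪M/𝔪²M`, and the balanced (2,2) ι-stable
colength-4 submodules `N′ ⊂ M` (the (0,1) candidates on `R`, [VIII] 4.1 (c)). Report
`run/shared/lean/b2b/hodge-weil/b2b-hweil-pv3-g16/H2-EXISTENCE-SIDE-9.md`, CLAIM TABLE v37 (LADDER C240) row pv3-g16. Def-free, fully proved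
ELEMENTARY statements (integer bookkeeping); the module theory is in the docstrings and the report. HONEST FRAMING: census / structure results about
one cell of the ladder's H2 test on the existence side, on the Jacobian locus only; no case of the Hodge conjecture is proved; nothing here is a
rung; no statement of [Markman 2025] is used; nothing here depends on (LP) or on 'ker ob = ann(ch)'.

§2 THE MODULE ON `R` (THEOREM 2.3 / COROLLARY 2.4): `M = coker(Φ_M : R⁴ → R³)` on `f₀ = (x̃, x̃^ι)` (ι-fixed), `G₁ = (θ₋w̃, 0)`, `G₂ = ιG₁`, relations
`x̃G₁ = θ₋w̃f₀`, `z′G₁ = θ₋y′f₀` and conjugates (`θ₊ = y′x̃ − z′w̃`), one second syzygy, `pd = 2`; `M/𝔪³M = R/𝔪³·f₀ ⊕ P·G₁ ⊕ P^ι·G₂` is a DIRECT sum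
(`P ≅ k[y,w]/𝔪³`), `V = k₊² ⊕ k₋`, `U = k₊² ⊕ k₋⁶`, `𝔪²M/𝔪³M = k₊¹³ ⊕ k₋³`, `𝔪³M/𝔪⁴M = k₊⁴ ⊕ k₋²⁴` (`record_module_presentation`,
`record_module_truncations`). §3 THE CENSUS (THEOREM 3.8): a balanced quotient has radical-layer type I (1;1;1;1), II (1;2;1), III (2;1;1), IV (2;2)
or V (3;1) (`balanced_types_length_four`); types II–V are Grassmannian bundles `Gr(8 − d, c − 8)` / `Gr(15 − d, c − 15)` over explicit bases
(`fibre_grassmannian_dims`), type I sits in projective spaces `ℙ^{μ_s − 1}` over colength-3 curvilinear submodules (`type_one_socle_bounds`); every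
family has dimension `≥ 2` (`census_minimum_two`), so by the certified family mechanism the record curve carries NO (0,1) object, and with [VIII]
THEOREM 3.4 the row `(E2)_x^{node} ∩ {j = 0}` is EMPTY. §1 errata bookkeeping (`errata_normalisation_epsilon`).

What is NOT here: sheaves, `ψ`, the family mechanism, the Quot schemes, the machine checks (`code/pv3-g16/census9.py`). 0 unconditional rungs
above the floor.
-/

set_option linter.dupNamespace false

namespace Summit.HodgeConjecture.HodgeConjecture.WeilTypeLadder

section H2W2CornerNine

/-- THEOREM 2.3 (report §2): on the record curve the vertex module `M = F̂_{t₀,0}` has `3` generators (`f₀`, `G₁`, `G₂`), `4` relations (`ρ₁`, `ρ₂`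
and their ι-conjugates) and exactly `1` second syzygy (`(z′ρ₁ − x̃ρ₂) − (z′^ιρ₁^ι − x̃^ιρ₂^ι) = 0`), so the free resolution `0 → R → R⁴ → R³ → M → 0`
has Euler characteristic `3 − 4 + 1 = 0 = rank M` (a torsion module on the 4-dimensional regular local ring), `pd M = 2` and, by Auslander–Buchsbaum,
`depth M = 4 − 2 = 2`; the quotient `M/Rf₀ ≅ 𝒪_{Π′} ⊕ 𝒪_{ιΠ′}` has two summands of dimension `2` each and `Rf₀ ≅ 𝒪_D` has dimension `3`. [§2.2–2.3] -/
theorem record_module_presentation :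
    ((3 : ℤ) - 4 + 1 = 0) ∧ ((4 : ℤ) - 2 = 2) ∧ ((2 : ℤ) + 2 = 4 ∧ (4 : ℤ) - 1 = 3 ∧ (4 : ℤ) - 2 = 2) := by
  norm_num

/-- COROLLARY 2.4 (report §2): dimensions of the truncations. `M/𝔪³M = R/𝔪³ ⊕ P ⊕ P^ι` with `dim R/𝔪³ = 1 + 4 + 10 = 15`, `dim P = dim k[y,w]/𝔪³ =
1 + 2 + 3 = 6`: total `27`; `M/𝔪⁴M`: `35 + 10 + 10 = 55` (`dim R/𝔪⁴ = 35`, `dim k[y,w]/𝔪⁴ = 10`); graded pieces with ι-signs `(dim₊, dim₋)`: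
`V = (2, 1)` (`f₀`, `A = G₁ + G₂` even; `B = G₁ − G₂` odd), `U = 𝔪M/𝔪²M`: `3·4 − 4 = 8 = 2 + 6` (four linear syzygies `x⊗G₁, z⊗G₁, x⊗G₂, z⊗G₂`;
`U₊ = ⟨yB, wB⟩`, `U₋ = ⟨xf₀, yf₀, zf₀, wf₀, yA, wA⟩`), `𝔪²M/𝔪³M = (10 + 3, 3) = (13, 3)` (`𝔪₂f₀ ⊕ P₂A | P₂B = Σ`), `𝔪³M/𝔪⁴M = (4, 20 + 4) = (4, 24)`;
parity totals `2 + 2 + 13 = 17`, `1 + 6 + 3 = 10`, `17 + 10 = 27`, and `17 + 4 = 21`, `10 + 24 = 34`, `21 + 34 = 55`. [§2.4; machine A1–A9] -/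
theorem record_module_truncations :
    ((1 : ℤ) + 4 + 10 = 15 ∧ (1 : ℤ) + 2 + 3 = 6 ∧ (15 : ℤ) + 6 + 6 = 27) ∧
    ((35 : ℤ) + 10 + 10 = 55) ∧
    ((3 : ℤ) * 4 - 4 = 8 ∧ (2 : ℤ) + 6 = 8 ∧ (10 : ℤ) + 3 = 13 ∧ (20 : ℤ) + 4 = 24) ∧
    ((2 : ℤ) + 2 + 13 = 17 ∧ (1 : ℤ) + 6 + 3 = 10 ∧ (17 : ℤ) + 10 = 27 ∧ (17 : ℤ) + 4 = 21 ∧ (10 : ℤ) + 24 = 34 ∧ (21 : ℤ) + 34 = 55) := by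
  norm_num

/-- LEMMA 3.1 (report §3): the radical-layer types of a BALANCED length-4 quotient `T = M/N′` (two composition factors of each ι-sign; the top is a
quotient of `V = k₊² ⊕ k₋`, so `c₀ ≤ 3`, and each layer has signs opposite to the layer generating it). Writing a sign as `±1` and a type as its
sequence of layer signs: I `(σ, −σ, σ, −σ)`, II `(σ; −σ, −σ; σ)`, III `(+1, −1; σ; −σ)`, IV `(+1, +1; −1, −1)` and `(+1, −1; +1, −1)`, V
`(+1, +1, −1; −1)` all have sign-sum `0` (balanced) for `σ = ±1`, while the excluded patterns `(σ, −σ, σ, σ)` [(1;1;2)], `(σ; −σ, −σ, −σ)` [(1;3)]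
and `(+1, +1; −1; +1)` [(2;1;1) with top (+,+)] have sign-sum `±2 ≠ 0`; the layer lengths add up to `4` in each listed type. [§3.1] -/
theorem balanced_types_length_four (σ : ℤ) (hσ : σ = 1 ∨ σ = -1) :
    (σ + -σ + σ + -σ = 0 ∧ σ + (-σ + -σ) + σ = 0 ∧ (1 + -1) + σ + -σ = 0 ∧ ((1 : ℤ) + 1 + (-1 + -1) = 0) ∧
      ((1 : ℤ) + -1 + (1 + -1) = 0) ∧ ((1 : ℤ) + 1 + -1 + -1 = 0)) ∧
    (σ + -σ + σ + σ ≠ 0 ∧ σ + (-σ + -σ + -σ) ≠ 0 ∧ ((1 : ℤ) + 1 + -1 + 1 ≠ 0)) ∧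
    ((1 : ℤ) + 1 + 1 + 1 = 4 ∧ (1 : ℤ) + 2 + 1 = 4 ∧ (2 : ℤ) + 1 + 1 = 4 ∧ (2 : ℤ) + 2 = 4 ∧ (3 : ℤ) + 1 = 4) := by
  refine ⟨⟨by ring, by ring, by ring, by norm_num, by norm_num, by norm_num⟩, ⟨?_, ?_, by norm_num⟩, by norm_num⟩
  · rcases hσ with rfl | rfl <;> norm_num
  · rcases hσ with rfl | rfl <;> norm_num

/-- LEMMA 3.2 / §§3.3–3.6 (report): in `M₃ = M/𝔪³M` (even part of dimension `17`, odd part `10`) a balanced `N′ = N′₊ ⊕ N′₋` has `dim N′₊ = 15`,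
`dim N′₋ = 8`, and for a fixed side the other side ranges over a Grassmannian `Gr(8 − d, c − 8)` (odd side free) resp. `Gr(15 − d, c − 15)` (even side
free) of dimension `(8 − d)(c − 8)` resp. `(15 − d)(c − 15)`. The values `(d, c)` computed in the report and the resulting family dimensions
(base + fibre): type V / IV(+,+): `(3, 10)`, fibre `(8 − 3)(10 − 8) = 10` over a point, with closed part `Gr(5, 6)` of dimension `5` (type V); top `(+,−)`
with `U²₊ ⊂ N′` (IV(+,−) ∪ III(+)): `(6, 9)`, fibre `2`, base `3`, total `5` (and `(5, 9)`: fibre `3`, base `2`, total `5`; `(4,9)`: `4 + 2 = 6`);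
III(−): `(12, 16)`, fibre `(15 − 12)(16 − 15) = 3`, base `2` or `3`, totals `5`, `6`; II(−): `(6 + ρ, 9)`, fibre `2 − ρ`, base `4`, total `6 − ρ`;
II(+): `(12 + ρ, 16)`, fibre `3 − ρ`, base `3`, total `6 − ρ` — for `ρ = dim⟨a, b⟩ ∈ {0, 1, 2}`. [§3.2–3.6; machine B1–B8] -/
theorem fibre_grassmannian_dims (ρ : ℤ) (hρ : 0 ≤ ρ ∧ ρ ≤ 2) :
    ((17 : ℤ) - 2 = 15 ∧ (10 : ℤ) - 2 = 8) ∧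
    ((8 - 3) * (10 - 8) = (10 : ℤ) ∧ (6 : ℤ) - 1 = 5) ∧
    ((8 - 6) * (9 - 8) = (2 : ℤ) ∧ (3 : ℤ) + 2 = 5 ∧ (8 - 5) * (9 - 8) = (3 : ℤ) ∧ (2 : ℤ) + 3 = 5 ∧ (8 - 4) * (9 - 8) = (4 : ℤ) ∧ (2 : ℤ) + 4 = 6) ∧
    ((15 - 12) * (16 - 15) = (3 : ℤ) ∧ (2 : ℤ) + 3 = 5 ∧ (3 : ℤ) + 3 = 6) ∧
    ((8 - (6 + ρ)) * (9 - 8) = 2 - ρ ∧ 4 + (2 - ρ) = 6 - ρ) ∧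
    ((15 - (12 + ρ)) * (16 - 15) = 3 - ρ ∧ 3 + (3 - ρ) = 6 - ρ) ∧
    (4 ≤ 6 - ρ) := by
  refine ⟨by norm_num, by norm_num, by norm_num, by norm_num, ⟨by ring, by ring⟩, ⟨by ring, by ring⟩, by omega⟩

/-- §3.7 (report): type I via the colength-3 curvilinear `N″ = N′ + soc`. The family through `N′` is the projective space `ℙ((N″ ⊗ k)_s^∨)` of
dimension `μ_s(N″) − 1`, spread over the stratum of `N″`. Lower bounds from `M₃`: top sign `−` (so `s = +`): `dim N″₊ = 17 − 1 = 16` and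
`(𝔪N″)₊ ⊂ U²₊` of dimension `13`, so `μ₊(N″) ≥ 16 − 13 = 3` and the fibre alone has dimension `≥ 2`; top sign `+` (`s = −`): `dim N″₋ = 10 − 1 = 9`,
`(𝔪N″)₋ ⊂ ⟨xh₊, yh₊, zh₊, wh₊⟩ + Σ` of dimension `≤ 4 + 3 = 7`, so `μ₋(N″) ≥ 9 − 7 = 2` (fibre `≥ 1`), and `≥ 9 − (2 + 3) = 4` when `h̄₊ = Ā`
(fibre `≥ 3`); the colength-2 step: `μ₊(N²) = 4 − d₂` with `d₂ = dim⟨a, b, ℓ₀y, ℓ₀w⟩ ∈ {2, 3}`, so curvilinear length-3 quotients with `λ′ ≠ 0` exist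
(`μ₊(N²) ≥ 2`) iff `d₂ = 2`; in that case the stratum of `N″` has dimension `1 + 1 + 1 = 3` and the family has dimension `≥ 3 + 2 − 1 = 4` when
`μ₋ = 2`, `≥ μ₋ − 1 ≥ 2` when `μ₋ ≥ 3` (machine: `μ₋ = 3`, `μ₋ = 4`, `μ₊ = 4` in the sampled cases). [§3.7; machine C1–C11] -/
theorem type_one_socle_bounds (μ d₂ : ℤ) (hd : d₂ = 2 ∨ d₂ = 3) :
    ((17 : ℤ) - 1 = 16 ∧ (16 : ℤ) - 13 = 3 ∧ (2 : ℤ) ≤ 3 - 1) ∧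
    ((10 : ℤ) - 1 = 9 ∧ (4 : ℤ) + 3 = 7 ∧ (9 : ℤ) - 7 = 2 ∧ (9 : ℤ) - (2 + 3) = 4 ∧ (2 : ℤ) ≤ 4 - 1) ∧
    ((2 ≤ 4 - d₂ ↔ d₂ = 2) ∧ (1 : ℤ) + 1 + 1 = 3 ∧ (3 : ℤ) + 2 - 1 = 4) ∧
    (2 ≤ μ → (μ = 2 → (2 : ℤ) ≤ 3 + μ - 1) ∧ (3 ≤ μ → 2 ≤ μ - 1)) := by
  refine ⟨by norm_num, by norm_num, ⟨?_, by norm_num, by norm_num⟩, ?_⟩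
  · rcases hd with rfl | rfl <;> norm_num
  · intro _; constructor <;> intro h <;> omega

/-- THEOREM 3.8 / COROLLARY 3.9 (report): the minimum over the family dimensions by type — V `5`, IV(+,+) `10`, IV(+,−)/III(+) `5`, III(−) `5`,
II `6 − ρ` (`ρ ≤ 2`), I `≥ 2` — is `≥ 2`; so every balanced ι-stable colength-4 submodule of the record-curve vertex module lies on an irreducible
family of pairwise distinct such submodules of dimension `≥ 2`, hence (family mechanism, `e₁^ι ≥ 2`) no (0,1) object has `b = n`, `j = 0` and
pinching triple on `R`; together with [VIII] THEOREM 3.4 (off `R`) the row `(E2)_x^{node} ∩ {j = 0}` is EMPTY, for all `2·16 = 32` node parameters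
`b = x ± n` (J[2]-symmetry, [VII] 3.1). The H2 requirement is `e₁^ι = 1 < 2`. [§3.8–3.9] -/
theorem census_minimum_two (ρ dI : ℤ) (hρ : 0 ≤ ρ ∧ ρ ≤ 2) (hI : 2 ≤ dI) :
    (2 ≤ (5 : ℤ) ∧ 2 ≤ (10 : ℤ) ∧ 2 ≤ (5 : ℤ) ∧ 2 ≤ (5 : ℤ) ∧ 2 ≤ 6 - ρ ∧ 2 ≤ dI) ∧
    (min (min (min (5 : ℤ) 10) (min 5 5)) (min (6 - ρ) dI) ≥ 2) ∧ ((1 : ℤ) < 2) ∧ ((2 : ℤ) * 16 = 32) := by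
  refine ⟨⟨by norm_num, by norm_num, by norm_num, by norm_num, by omega, hI⟩, ?_, by norm_num, by norm_num⟩
  simp only [ge_iff_le, le_min_iff]
  refine ⟨⟨by norm_num, by norm_num⟩, by omega, hI⟩

/-- ERRATUM E-P3g15-1 (report §1.2 / `ERRATA-ADDENDUM-P3g16.md`): [VIII] 2.5 and 2.7 use ONE sign normalisation ('+' := the actual ι-sign `+ε`, so
the quadric generators of `N₁`, of actual sign `−ε`, are '−'); the ι-conjugation step of 2.7 gives `(1 + ε)·B̄ = 0` and `(1 − ε)·Ā = 0` with
`ε ∈ {±1}`, i.e. exactly one of the two θ-classes survives: for `ε = 1` the even one (`B̄ = 0`), for `ε = −1` the odd one (`Ā = 0`); `(1 + ε)(1 − ε) =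
1 − ε² = 0`; and the actual signs of `A(g) = (θ₋g, θ₊g^ι)`, `B(g) = (θ₋g, −θ₊g^ι)` under `(a,b) ↦ (b^ι, a^ι)` are `+1`, `−1` independently of `ε`
(swap of the two coordinates composed with the identity resp. with `−1` on the second: eigenvalues `+1` on `(1,1)`, `−1` on `(1,−1)`). WLOG `ε = +1`:
the other linearisation multiplies every sign by `−1` and exchanges the roles of `A` and `B`. [E-P3g15-1] -/
theorem errata_normalisation_epsilon (ε : ℤ) (hε : ε = 1 ∨ ε = -1) :
    ((1 + ε) * (1 - ε) = 1 - ε ^ 2 ∧ 1 - ε ^ 2 = 0) ∧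
    ((ε = 1 → (1 + ε ≠ 0 ∧ 1 - ε = 0)) ∧ (ε = -1 → (1 + ε = 0 ∧ 1 - ε ≠ 0))) ∧
    ((1 : ℤ) * 1 = 1 ∧ (1 : ℤ) * (-1) = -1 ∧ (-1 : ℤ) * ε = -ε) := by
  refine ⟨⟨by ring, ?_⟩, ⟨?_, ?_⟩, ⟨by norm_num, by norm_num, by ring⟩⟩
  · rcases hε with rfl | rfl <;> norm_num
  · intro h; subst h; norm_num
  · intro h; subst h; norm_num

end H2W2CornerNine

/-!
## ADDENDUM A (pv3-g16, 2026-08-20): the FIXED NODE `x ∈ J[2]`, `b ∈ Θ + x`, `x` on the pinching curves — report [IX] §A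

With `(G)`: `D_b ∩ J[2] = {x}` an ordinary A₁ point of `S_b`, the vertex module is `F̂_x = coker[(−θ₋, f̃, 0), (0, θ₊, 0), (−θ₊, 0, f̃^ι), (0, 0, θ₋)]` on
`f₀ = (f̃g, f̃^ιg^ι)` (ι-fixed), `G₁ = (θ₋g, 0)`, `G₂ = ιG₁` (`θ₊ = w + q₂ + …` smooth, `f̃ = x + f₂ + …`, `θ₊θ₋ ≡ −w²`); `V = k₊² ⊕ k₋`, `U = k₊² ⊕ k₋⁶`,
`𝔪²M/𝔪³M = k₊¹² ⊕ k₋³`, `LS(M) = ⟨w⊗A, x⊗A + 2w⊗f₀⟩ ⊕ ⟨x⊗B, w⊗B⟩`; the balanced ι-Quot² (`ℓ′ = 2`) and ι-Quot⁴ (`ℓ′ = 4`) censuses both give families of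
dimension `≥ 2`, so `(E2)_x^W ∩ {j = 0, (G)}` is EMPTY (`fixed_node_truncations`, `fixed_node_colength_two`, `fixed_node_fibre_dims`, `fixed_node_census`).
Machine: `code/pv3-g16/fixmod.py`, `fixcensus9.py` (75 checks).
-/

section H2W2CornerNineAddendumA

/-- [IX] A.2–A.3: dimensions for the fixed-node module. `dim R/(w², 𝔪³) = 15 − 1 = 14`, `dim k[y,z]/𝔪³ = 6`: `M/𝔪³M` has dimension `14 + 6 + 6 = 26`;
`dim R/(w², 𝔪⁴) = 35 − (1 + 4) = 30`, `dim k[y,z]/𝔪⁴ = 10`: `M/𝔪⁴M` has dimension `30 + 10 + 10 = 50`; `U = 𝔪M/𝔪²M`: `12 − 4 = 8 = 2 + 6` (four linear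
syzygies, two of each sign); `𝔪²M/𝔪³M = ((10 − 1) + 3, 3) = (12, 3)`; `𝔪³M/𝔪⁴M = (4, (20 − 4) + 4) = (4, 20)`; parity totals `2 + 2 + 12 = 16`,
`1 + 6 + 3 = 10`, `16 + 10 = 26`, `16 + 4 = 20`, `10 + 20 = 30`, `20 + 30 = 50`; `θ₊θ₋ = (w + q)(−w + q) = −w² + q²` has no `wq` cross term. [§A.2–A.3; machine
F1–F4] -/
theorem fixed_node_truncations (w q : ℤ) :
    ((15 : ℤ) - 1 = 14 ∧ (14 : ℤ) + 6 + 6 = 26 ∧ (35 : ℤ) - (1 + 4) = 30 ∧ (30 : ℤ) + 10 + 10 = 50) ∧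
    ((12 : ℤ) - 4 = 8 ∧ (2 : ℤ) + 6 = 8 ∧ (10 - 1) + 3 = (12 : ℤ) ∧ (20 - 4) + 4 = (20 : ℤ)) ∧
    ((2 : ℤ) + 2 + 12 = 16 ∧ (1 : ℤ) + 6 + 3 = 10 ∧ (16 : ℤ) + 10 = 26 ∧ (16 : ℤ) + 4 = 20 ∧ (10 : ℤ) + 20 = 30 ∧ (20 : ℤ) + 30 = 50) ∧
    ((w + q) * (-w + q) = -w ^ 2 + q ^ 2) := by
  refine ⟨by norm_num, by norm_num, by norm_num, by ring⟩

/-- [IX] THEOREM A.4 (`ℓ′ = 2` at the fixed node): by the general form of [VIII] 3.2–3.3, `dim P(H) = dim V_{−s} + 3 − r(H)` with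
`r(H) ≤ min(4, dim LS^{[V_s]}) = 2` (both signed parts of `LS` are 2-dimensional here); with `dim V₊ = 2`, `dim V₋ = 1` this is `≥ 1 + 3 − 2 = 2` for `s = +`
and `≥ 2 + 3 − 2 = 3` for `s = −` (machine: `r = 2, 2, 1` giving `2, 3, 3`); every value is `≥ 2`, so the balanced colength-2 junk moves and there is no
(0,1) object with `ℓ′ = 2`. [§A.4; machine F5] -/
theorem fixed_node_colength_two (r : ℤ) (hr : 0 ≤ r ∧ r ≤ 2) :
    (2 ≤ 1 + 3 - r) ∧ (3 ≤ 2 + 3 - r) ∧ ((1 : ℤ) + 3 - 2 = 2 ∧ (2 : ℤ) + 3 - 2 = 3 ∧ (1 : ℤ) + 3 - 1 = 3) ∧ (min (4 : ℤ) 2 = 2) := by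
  refine ⟨by omega, by omega, by norm_num, by norm_num⟩

/-- [IX] THEOREM A.5 (`ℓ′ = 4` at the fixed node): in `M₃` (even `16`, odd `10`) `dim N′₊ = 14`, `dim N′₋ = 8`; fibres `Gr(8 − d, c − 8)` resp.
`Gr(14 − d, c − 14)` with the hand/machine values `(d, c)`: V / IV(+,+) `(3, 10)`: `(8 − 3)(10 − 8) = 10` (⊃ `ℙ⁵`); top `(+,−)`, `U²₊ ⊂ N′`: `(6, 9)`: `2`, base `3`,
total `5`, and for `λ = 0` `(d, 9)` with `d ∈ {5, 6}`: fibre `8 − d ∈ {2, 3}`, base `2`, total `≥ 4`; III(−): `(11, 15)`: `(14 − 11)(15 − 14) = 3`, base `2`, total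
`5`; II(−): `(6 + ρ, 9)`: fibre `2 − ρ`, base `4`, total `6 − ρ`; II(+): `(11 + ρ, 15)`: fibre `3 − ρ`, base `3`, total `6 − ρ` (`ρ ∈ {1, 2}` since `β ≠ 0`); type I:
`μ₊(N″) ≥ 15 − 12 = 3` (top `−`), `μ₋(N″) ≥ 9 − 7 = 2` in general and `≥ 9 − 6 = 3` for `h̄₊ = Ā` (top `+`), `μ₊(N²) = 4 − d₂` (`d₂ ∈ {2,3}`), strata of
dimension `3`, so families of dimension `≥ min(3 + 2 − 1, 3 − 1) = 2`. [§A.5; machine F6–F13] -/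
theorem fixed_node_fibre_dims (ρ d : ℤ) (hρ : 1 ≤ ρ ∧ ρ ≤ 2) (hd : d = 5 ∨ d = 6) :
    ((16 : ℤ) - 2 = 14 ∧ (10 : ℤ) - 2 = 8) ∧
    ((8 - 3) * (10 - 8) = (10 : ℤ) ∧ (8 - 6) * (9 - 8) = (2 : ℤ) ∧ (3 : ℤ) + 2 = 5 ∧ (2 ≤ 8 - d ∧ 8 - d ≤ 3) ∧ 4 ≤ 2 + (8 - d)) ∧
    ((14 - 11) * (15 - 14) = (3 : ℤ) ∧ (2 : ℤ) + 3 = 5) ∧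
    ((8 - (6 + ρ)) * (9 - 8) = 2 - ρ ∧ 4 + (2 - ρ) = 6 - ρ ∧ (14 - (11 + ρ)) * (15 - 14) = 3 - ρ ∧ 3 + (3 - ρ) = 6 - ρ ∧ 4 ≤ 6 - ρ) ∧
    ((15 : ℤ) - 12 = 3 ∧ (9 : ℤ) - 7 = 2 ∧ (9 : ℤ) - 6 = 3 ∧ min (3 + 2 - 1 : ℤ) (3 - 1) = 2) := by
  refine ⟨by norm_num, ⟨by norm_num, by norm_num, by norm_num, by omega, by omega⟩, by norm_num, ⟨by ring, by ring, by ring, by ring, by omega⟩, by norm_num⟩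

/-- [IX] COROLLARY A.6: at the fixed node (under `(G)`) the minimum over all family dimensions — `ℓ′ = 2`: `2`, `3`; `ℓ′ = 4`: `10`, `5`, `4`, `5`, `6 − ρ`,
`6 − ρ`, `2` — is `2 ≥ 2`, and H2 needs `e₁^ι = 1 < 2`; with [VI] 5.3 (`x ∉ Z`: families of dimension `3`, `≥ 4`) and [VI] 4.3 (no fixed point ⇒ no junk) the
junk-carrying (0,1) candidates with `j = 0` are confined to the strata `(G1)–(G3)` where `(G)` fails, each of codimension `≥ 1` in the threefold `Θ + x`, i.e.
of dimension `≤ 3 − 1 = 2`, plus the exotic `ℓ′ = 0` row. [§A.6–A.7] -/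
theorem fixed_node_census (ρ : ℤ) (hρ : 1 ≤ ρ ∧ ρ ≤ 2) :
    (min (min (2 : ℤ) 3) (min (min 10 5) (min (min 4 5) (min (6 - ρ) 2))) = 2) ∧ ((1 : ℤ) < 2) ∧ ((3 : ℤ) - 1 = 2) ∧ (2 ≤ 6 - ρ) := by
  refine ⟨?_, by norm_num, by norm_num, by omega⟩
  have h1 : (2 : ℤ) ≤ 6 - ρ := by omega
  simp only [min_def]
  split_ifs <;> omega

end H2W2CornerNineAddendumA

end Summit.HodgeConjecture.HodgeConjecture.WeilTypeLadder
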